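import Summits.QuantumFields.YangMills.Theorems.BalabanUVNodesN06AtRecord11ObligationsSectB
import Literature.MathematicalPhysics.QuantumFieldTheory.Balaban1983to89.B9SectBStepFrameV7
import Literature.MathematicalPhysics.QuantumFieldTheory.Balaban1983to89.B9BackgroundsKLevelV1R

/-!
# BalabanUVNodes ∕ N06 ([B9], `Dag.B9_main`) — THE SECT.-B OBLIGATION `hB` FROM ONE LETTERS DICTIONARY `SectBFrame₇`, CLASS-PARAMETRIC
# (the R-TWIN of `BalabanUVNodesN06SectBOfFrameV7` for the CASCADE-R edition of the certificate: the backgrounds family is a PARAMETER — in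
# particular def-Y's `bg9YR … R₁ R₂` of `B9BackgroundsKLevelV1R`, to which `bg9Y` and `bg9YP` specialise by `rfl`)

Track A of `YM-PLAN.md` (cell `pub-ymgap`, HUMAN RULING D-0062), node **N06** = [Balaban1985BackgroundPropagators] Thms 3.1–3.15; seat
`pub-ymgap-dag-n06-c` gen 6; dag-lead GO-CASCADE-R (2026-08-27): every owner of a pinned theorem whose statement names `bg9Y` as a backgrounds FAMILY
files ONE class-parametric twin, so that the certificate's edition 8 is typed at generic `R` and specialises by `rfl`.  The v7 row-13 adapter (`BalabanUVNodesN06SectBOfFrameV7`) names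
`bg9Y (Matrix (Fin N) (Fin N) ℂ) (specialUnitaryUnits (Fin N))` as the family argument of `SectBFrame₇`, `Thm32Printed`, `Thm33Printed`, `SectBStepPrinted`;
its proof (`B9SectBStepFrameV7.sectBStepPrinted_of_sectBFrame₇` + the geometry-only sign schema `modelSignsOn_geo9K`) never reads the class.  THIS FILE
states it for an ARBITRARY backgrounds family over the record's member index (`hB_obligation_of_sectBFrame₇_bg`) and, by name, at def-Y's
class-parametric carrier `bg9YR 𝔸 G R₁ R₂` (`hB_obligation_of_sectBFrame₇R`), with the kernel families as parameters (an instance supplies e.g.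
`B9BackgroundsKLevelV1R.kernelFamilyR R₁ R₂ (ops x).Gp`).

WHAT THIS MODULE DOES (kernel bookkeeping BY NAME; 0 `def`, 0 `sorry`, standard axioms; COUNT-NEUTRAL, `--supports` K1⁷ as helper): two theorems, both
one application of `sectBStepPrinted_of_sectBFrame₇`.

HONEST FRAMING.  `F` is a HYPOTHESIS: no `SectBFrame₇` over the record's operator layer exists in the tree; its fields are the dictionary contract an
instance must meet; N06 is NOT discharged.  One finite four-torus programme at fixed `ε` — NOT ℝ⁴, NOT OS, NOT a mass
gap, NOT Clay.  No `def`.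
-/

noncomputable section

namespace Summit.QuantumFields.YangMills.BalabanUVNodes.N06SectBOfFrameV7R

open Literature.MathematicalPhysics.QuantumFieldTheory.Balaban1983to89
open Literature.MathematicalPhysics.QuantumFieldTheory.Balaban1983to89.Node00
open Literature.MathematicalPhysics.QuantumFieldTheory.Balaban1983to89.B9PinMembersKLevelV1 (MemberY geo9Y bg9Y)
open Literature.MathematicalPhysics.QuantumFieldTheory.Balaban1983to89.B9PinGeometryKLevelV1 (c35Y)
open Literature.MathematicalPhysics.QuantumFieldTheory.Balaban1983to89.B7Prop2SpecialUnitary (specialUnitaryUnits)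
open Literature.MathematicalPhysics.QuantumFieldTheory.Balaban1983to89.B9GeoNormsKLevelModelSignsV1 (modelSignsOn_geo9K)
open Literature.MathematicalPhysics.QuantumFieldTheory.Balaban1983to89.B9SectBStepFrameV7 (SectBFrame₇ sectBStepPrinted_of_sectBFrame₇)
open Literature.MathematicalPhysics.QuantumFieldTheory.Balaban1983to89.B9BackgroundsKLevelV1R (RegFamY bg9YR)
open scoped Matrix.Norms.L2Operator

variable {N : ℕ}

/-- **ROW 13's `hB` FROM ONE `SectBFrame₇` OVER AN ARBITRARY BACKGROUNDS FAMILY of the record's member index** (Sect. B pp. 400–407; Theorem 3.4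
p. 400): the sign schema is the geometry's (`modelSignsOn_geo9K x.toKIdx`), the rest is `sectBStepPrinted_of_sectBFrame₇` — so the statement holds for
`bg9Y`, `bg9YP`, `bg9YR … R₁ R₂` alike.  `F` is a hypothesis; nothing of print asserted.
[cite: Balaban1985BackgroundPropagators, Thm 3.4 p.400 + Sect. B (3.50)–(3.86) pp.400–407 + Thms 3.1–3.3 pp.397–399 + (3.39)–(3.41) p.397] -/
theorem hB_obligation_of_sectBFrame₇_bg (θ₃ : Stage3Params) (Mstar : ℕ)
    (bg : MemberY θ₃.d₆ θ₃.ℓ₆ θ₃.hd' θ₃.hL' θ₃.b₀ θ₃.b₁ Mstar → B9.Backgrounds)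
    (Gp GA : ∀ x : MemberY θ₃.d₆ θ₃.ℓ₆ θ₃.hd' θ₃.hL' θ₃.b₀ θ₃.b₁ Mstar, B9.KernelFamily (geo9Y x) (bg x))
    (Cinv : ∀ x : MemberY θ₃.d₆ θ₃.ℓ₆ θ₃.hd' θ₃.hL' θ₃.b₀ θ₃.b₁ Mstar, B9.SiteKernel (geo9Y x) (bg x))
    (IsAnalyticExt : ∀ x : MemberY θ₃.d₆ θ₃.ℓ₆ θ₃.hd' θ₃.hL' θ₃.b₀ θ₃.b₁ Mstar, B9.KernelFamily (geo9Y x) (bg x) → (bg x).Cfg → ℝ → Prop)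
    [∀ x : MemberY θ₃.d₆ θ₃.ℓ₆ θ₃.hd' θ₃.hL' θ₃.b₀ θ₃.b₁ Mstar, Fintype (geo9Y x).Site]
    [∀ x : MemberY θ₃.d₆ θ₃.ℓ₆ θ₃.hd' θ₃.hL' θ₃.b₀ θ₃.b₁ Mstar, DecidableEq (geo9Y x).Site]
    [∀ x : MemberY θ₃.d₆ θ₃.ℓ₆ θ₃.hd' θ₃.hL' θ₃.b₀ θ₃.b₁ Mstar, Nonempty (geo9Y x).Site]
    {𝔸 : Type} [NormedRing 𝔸] [NormedAlgebra ℂ 𝔸] [CompleteSpace 𝔸]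
    {ι κ : Type} [Fintype ι] [DecidableEq ι] [Fintype κ] [LinearOrder κ] (b : Module.Basis ι ℝ 𝔸)
    (S : MemberY θ₃.d₆ θ₃.ℓ₆ θ₃.hd' θ₃.hL' θ₃.b₀ θ₃.b₁ Mstar → Type) [∀ x, Fintype (S x)] [∀ x, DecidableEq (S x)]
    (F : SectBFrame₇ c35Y geo9Y bg Gp b κ S GA Cinv IsAnalyticExt)
    (hd : F.dB = θ₃.d₆ + 1)
    (h32 : B9.Thm32Printed (θ₃.d₆ + 1) c35Y geo9Y bg Cinv) (h33 : B9.Thm33Printed c35Y geo9Y bg Gp GA) :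
    B9.SectBStepPrinted (θ₃.d₆ + 1) c35Y geo9Y bg Gp GA Cinv IsAnalyticExt := by
  rw [← hd] at h32 ⊢
  exact sectBStepPrinted_of_sectBFrame₇ F (P := fun _ lam => lam.isRight = true) (fun x => modelSignsOn_geo9K x.toKIdx) h32 h33

/-- **ROW 13's `hB` AT def-Y's CLASS-PARAMETRIC CARRIER `bg9YR 𝔸 G R₁ R₂`** (the CASCADE-R edition; `bg9Y = bg9YR … regY335 regY336` and
`bg9YP = bg9YR … regYP335 regYP336` by `rfl`), kernel families as parameters (e.g. `kernelFamilyR R₁ R₂ (ops x).Gp`).  `F` is a hypothesis; nothing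
of print asserted. [cite: Balaban1985BackgroundPropagators, Thm 3.4 p.400 + Sect. B pp.400–407 + (3.35)–(3.38) p.396 + Thms 3.1–3.3 pp.397–399] -/
theorem hB_obligation_of_sectBFrame₇R (θ₃ : Stage3Params) (Mstar : ℕ)
    (R₁ R₂ : RegFamY θ₃.d₆ θ₃.ℓ₆ θ₃.hd' θ₃.hL' θ₃.b₀ θ₃.b₁ Mstar (Matrix (Fin N) (Fin N) ℂ))
    (Gp GA : ∀ x : MemberY θ₃.d₆ θ₃.ℓ₆ θ₃.hd' θ₃.hL' θ₃.b₀ θ₃.b₁ Mstar,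
      B9.KernelFamily (geo9Y x) (bg9YR (Matrix (Fin N) (Fin N) ℂ) (specialUnitaryUnits (Fin N)) R₁ R₂ x))
    (Cinv : ∀ x : MemberY θ₃.d₆ θ₃.ℓ₆ θ₃.hd' θ₃.hL' θ₃.b₀ θ₃.b₁ Mstar,
      B9.SiteKernel (geo9Y x) (bg9YR (Matrix (Fin N) (Fin N) ℂ) (specialUnitaryUnits (Fin N)) R₁ R₂ x))
    (IsAnalyticExt : ∀ x : MemberY θ₃.d₆ θ₃.ℓ₆ θ₃.hd' θ₃.hL' θ₃.b₀ θ₃.b₁ Mstar,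
      B9.KernelFamily (geo9Y x) (bg9YR (Matrix (Fin N) (Fin N) ℂ) (specialUnitaryUnits (Fin N)) R₁ R₂ x) →
        (bg9YR (Matrix (Fin N) (Fin N) ℂ) (specialUnitaryUnits (Fin N)) R₁ R₂ x).Cfg → ℝ → Prop)
    [∀ x : MemberY θ₃.d₆ θ₃.ℓ₆ θ₃.hd' θ₃.hL' θ₃.b₀ θ₃.b₁ Mstar, Fintype (geo9Y x).Site]
    [∀ x : MemberY θ₃.d₆ θ₃.ℓ₆ θ₃.hd' θ₃.hL' θ₃.b₀ θ₃.b₁ Mstar, DecidableEq (geo9Y x).Site]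
    [∀ x : MemberY θ₃.d₆ θ₃.ℓ₆ θ₃.hd' θ₃.hL' θ₃.b₀ θ₃.b₁ Mstar, Nonempty (geo9Y x).Site]
    {ι κ : Type} [Fintype ι] [DecidableEq ι] [Fintype κ] [LinearOrder κ] (b : Module.Basis ι ℝ (Matrix (Fin N) (Fin N) ℂ))
    (S : MemberY θ₃.d₆ θ₃.ℓ₆ θ₃.hd' θ₃.hL' θ₃.b₀ θ₃.b₁ Mstar → Type) [∀ x, Fintype (S x)] [∀ x, DecidableEq (S x)]
    (F : SectBFrame₇ c35Y geo9Y (bg9YR (Matrix (Fin N) (Fin N) ℂ) (specialUnitaryUnits (Fin N)) R₁ R₂) Gp b κ S GA Cinv IsAnalyticExt)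
    (hd : F.dB = θ₃.d₆ + 1)
    (h32 : B9.Thm32Printed (θ₃.d₆ + 1) c35Y geo9Y (bg9YR (Matrix (Fin N) (Fin N) ℂ) (specialUnitaryUnits (Fin N)) R₁ R₂) Cinv)
    (h33 : B9.Thm33Printed c35Y geo9Y (bg9YR (Matrix (Fin N) (Fin N) ℂ) (specialUnitaryUnits (Fin N)) R₁ R₂) Gp GA) :
    B9.SectBStepPrinted (θ₃.d₆ + 1) c35Y geo9Y (bg9YR (Matrix (Fin N) (Fin N) ℂ) (specialUnitaryUnits (Fin N)) R₁ R₂) Gp GA Cinv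
      IsAnalyticExt :=
  hB_obligation_of_sectBFrame₇_bg θ₃ Mstar _ Gp GA Cinv IsAnalyticExt b S F hd h32 h33

end Summit.QuantumFields.YangMills.BalabanUVNodes.N06SectBOfFrameV7R
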